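import Literature.AnabelianGeometry.EtaleTheta.Discharge.Sec1Thm110ModelTateNV
import Literature.AnabelianGeometry.EtaleTheta.Discharge.Sec1Prop18ConjEpsPMModelChi
import Literature.AnabelianGeometry.EtaleTheta.SettingModelTateInversionAut
import HarnessLib

/-!
# [EtTh] Prop. 1.8 / Thm. 1.10 at the STAGE-2 («Tate shear») model, part A′: conjugation by `ε_±` on
# `Π^tp_C = Π^tp_X ⋊_ι ℤ/2` of `MuTwoSetting.modelχq p 1 2` PRESERVES THE COVERINGS of Def. 1.7, restricts to the
# cocycle-corrected inversion `ι` on `Π^tp_X`, and induces the NON-TRIVIAL inner automorphism `γ` of `Π^tp_Ċ` by `ε_±·ε_μ`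

S. Mochizuki, *The étale theta function and its Frobenioid-theoretic manifestations*, Publ. RIMS **45** (2009) [EtTh],
§1: Def. 1.7 p. 27, Prop. 1.8 p. 28 (γ "induces an isomorphism between the commutative diagrams" of the coverings
`Π^tp_Ÿ → Π^tp_Ẍ → Π^tp_Ẋ → Π^tp_X`, `Π^tp_Ċ → Π^tp_C`), Thm. 1.10 pp. 29–30 ("`γ : Π^tp_{Ċα} →̃ Π^tp_{Ċβ}`"); §2 p. 36 (`ι`)
[cite: MochizukiEtTh2009, Prop 1.8 p.28]. Layer L2 of the abc-iut cell, seat abc-iut-w5-d171 (gen 4; R78 Kummer lineage),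
row «K2-NV @ STAGE 2, NON-TRIVIAL γ» (abc-iut-w5-d140 g4's offer 12:41:19Z), part A′ — the stage-2 twin of
abc-iut-w5-d140's `Discharge/Sec1Prop18ConjEpsPMModelChi` (p444903), transcribed to abc-iut-w5-d249's F4q-C record
`MuTwoSetting.modelχq p 1 2` (`Π^tp_C := PiTpCq = Π^tp_X ⋊_{invActionχq} ℤ/2`, `inclX = inl`, `ε_± = (1, 1̄)`, `ε_μ = b`,
`Π^tp_Ẍ = Xddχq`; `epsPM_conj_inlCq`, `invActionχq_mem_Xddχq`, `invActionχq_ofAdd_one`, `sq_mem_map_inl_Xddχq`), abc-iut-L2-d1's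
stage-2 inversion API (`inversionχq_inl`, `inversionχq_inversionχq`, `gfpSnd_left_inversionχq`, `thm16i_inversionχq`),
abc-iut-w5-d140's `gfpInv_gfpOf_zero`, abc-iut-w5-d249/L2-t1's `gfpInv_bPowGfp`, and part 0 of this row (`epsZχq`,
`Discharge/Sec1Thm110ModelTateNV`, p446740) — all consumed BY NAME, nothing restated.

WHAT (`M := MuTwoSetting.modelχq p 1 2`):
* `conjEpsPMχq : Π^tp_C ≃ₜ* Π^tp_C` — conjugation by `ε_±`, an INVOLUTION (`ε_±² = 1`) with
  `conjEpsPMχq_inl : Γ (inclX x) = inclX (ι x)`; `conjEpsPMχq_epsZχq : Γ(a) = a⁻¹`, `conjEpsPMχq_epsMu : Γ(ε_μ) = ε_μ⁻¹`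
  (the defect cocycle of the stage-2 inversion vanishes on `inl(Γ)`: `inversionχq_inl`);
* **`preservesCoverings_conjEpsPMχq : PreservesCoverings (epsZχq p) (epsZχq p) conjEpsPMχq`** — `Γ(Π^tp_Ÿ) = Π^tp_Ÿ`
  (Thm. 1.6 (i) for `ι`, abc-iut-L2-d1), `Γ(Π^tp_Ẍ) = Π^tp_Ẍ` (`ι`-stability, abc-iut-w5-d249), `Γ(Π^tp_Ẋ) = Π^tp_Ẋ`,
  `Γ(Π^tp_X) = Π^tp_X`, `Γ(Π^tp_Ċ) = Π^tp_Ċ` (`Γ(ε_±ε_μ) = (ε_±ε_μ)·ε_μ⁻²`, `ε_μ² ∈ Π^tp_Ẍ`);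
* `gammaDotCχq : Π^tp_Ċ ≃ₜ* Π^tp_Ċ`, the inner automorphism by `ε_±·ε_μ ∈ Π^tp_Ċ` — print's `γ` for this instance —
  and **`gammaDotCχq_ne_refl`**: `γ ≠ id` (it sends `a` to `inclX(ι(b a b⁻¹))`, of degree `−1 ≠ 1`).

HONEST FRAMING: SEMI-SYNTHETIC model (the Tate-sheared χ-twisted root; not the tempered `π₁` of a curve) — consistency /
non-vacuity evidence for the typed interface ONLY; nothing of [EtTh] is asserted; typed ≠ proved; no side is taken on
[IUTchIII] Cor. 3.12. Definitions (class (b), no instance, no notation, no `Prop` fact): `epsPMχq` (abbrev), `conjEpsPMχq`,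
`gammaDotCχq`.
-/

noncomputable section

namespace Literature.AnabelianGeometry.EtaleTheta.SettingModel

open Literature.AnabelianGeometry.SemiGraphs Literature.AnabelianGeometry.AbsoluteAnabelian
open _root_.Topology _root_.Function

variable (p : ℕ) [Fact p.Prime]

/-! ### §1. Conjugation by `ε_±` on `Π^tp_C`: an involution restricting to `ι` -/

/-- `ε_± = (1, 1̄) ∈ Π^tp_C = Π^tp_X ⋊_ι ℤ/2` of the Tate instance (`= M.epsPM`, definitionally). [cite: MochizukiEtTh2009, Def 1.7 p.27] -/
abbrev epsPMχq : PiTpCq p 1 2 := SemidirectProduct.inr (Multiplicative.ofAdd 1)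

/-- It IS the record's `ε_±`. [cite: MochizukiEtTh2009, Def 1.7 p.27] -/
theorem epsPMχq_eq : epsPMχq p = (MuTwoSetting.modelχq p 1 2 even_two).epsPM := rfl

/-- `ε_±² = 1`. [cite: MochizukiEtTh2009, Def 1.7 p.27] -/
theorem epsPMχq_mul_self : epsPMχq p * epsPMχq p = 1 := by
  rw [epsPMχq, ← map_mul]
  have h : Multiplicative.ofAdd (1 : ZMod 2) * Multiplicative.ofAdd 1 = 1 := by decide
  rw [h, map_one]

/-- `ε_±⁻¹ = ε_±`. [cite: MochizukiEtTh2009, Def 1.7 p.27] -/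
theorem epsPMχq_inv : (epsPMχq p)⁻¹ = epsPMχq p := inv_eq_of_mul_eq_one_right (epsPMχq_mul_self p)

/-- **`Γ := conj ε_±`, a topological automorphism of `Π^tp_C`** (the extension of γ to `Π^tp_C` of Prop. 1.8). DEFINED.
[cite: MochizukiEtTh2009, Prop 1.8 p.28] -/
def conjEpsPMχq : PiTpCq p 1 2 ≃ₜ* PiTpCq p 1 2 where
  toMulEquiv := MulAut.conj (epsPMχq p)
  continuous_toFun := by
    change Continuous fun x : PiTpCq p 1 2 => epsPMχq p * x * (epsPMχq p)⁻¹
    exact (continuous_const.mul continuous_id).mul continuous_const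
  continuous_invFun := by
    change Continuous fun x : PiTpCq p 1 2 => (epsPMχq p)⁻¹ * x * epsPMχq p
    exact (continuous_const.mul continuous_id).mul continuous_const

/-- [cite: MochizukiEtTh2009, Prop 1.8 p.28] -/
theorem conjEpsPMχq_apply (x : PiTpCq p 1 2) : conjEpsPMχq p x = epsPMχq p * x * (epsPMχq p)⁻¹ := rfl

/-- **`Γ` restricts to `ι` on `Π^tp_X`**: `Γ (inclX x) = inclX (ι x)` (abc-iut-w5-d249's `epsPM_conj_inlCq`).
[cite: MochizukiEtTh2009, Prop 1.8 p.28] -/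
theorem conjEpsPMχq_inl (x : PiTpχq p 1 2) :
    conjEpsPMχq p (SemidirectProduct.inl x) = SemidirectProduct.inl (inversionχq p 1 2 x) :=
  epsPM_conj_inlCq p 1 2 x

/-- `Γ` is an involution. [cite: MochizukiEtTh2009, Prop 1.8 p.28] -/
theorem conjEpsPMχq_conjEpsPMχq (x : PiTpCq p 1 2) : conjEpsPMχq p (conjEpsPMχq p x) = x := by
  rw [conjEpsPMχq_apply, conjEpsPMχq_apply, epsPMχq_inv]
  have h := epsPMχq_mul_self p
  calc epsPMχq p * (epsPMχq p * x * epsPMχq p) * epsPMχq p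
      = (epsPMχq p * epsPMχq p) * x * (epsPMχq p * epsPMχq p) := by group
    _ = x := by rw [h, one_mul, mul_one]

/-- An involutive homomorphism that maps a subgroup INTO itself maps it ONTO itself. [folklore] -/
private theorem map_eq_of_le_of_involutive' {G : Type*} [Group G] (f : G →* G) (hf : ∀ x, f (f x) = x)
    (H : Subgroup G) (h : H.map f ≤ H) : H.map f = H := by
  refine le_antisymm h fun x hx => ?_
  exact ⟨f x, h ⟨x, hx, rfl⟩, hf x⟩

/-! ### §2. `Γ` preserves the coverings of Def. 1.7 -/

/-- `Γ (inclX a) = (inclX a)⁻¹` — on `inl(Γ)` the stage-2 inversion is `ι_Γ` (no defect), and `ι_Γ(a) = a⁻¹`.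
[cite: MochizukiEtTh2009, Prop 1.8 p.28] -/
theorem conjEpsPMχq_epsZχq : conjEpsPMχq p (epsZχq p) = (epsZχq p)⁻¹ := by
  change conjEpsPMχq p (SemidirectProduct.inl (SemidirectProduct.inl (gfpOf (FreeGroup.of 0)))) =
    (SemidirectProduct.inl (SemidirectProduct.inl (gfpOf (FreeGroup.of 0))))⁻¹
  rw [conjEpsPMχq_inl, inversionχq_inl, gfpInv_gfpOf_zero, map_inv, map_inv]

/-- `ι_Γ(b) = b⁻¹` for the loop `b` of `Γ`. [cite: MochizukiEtTh2009, §2 p.36] -/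
theorem gfpInv_gfpOf_one : gfpInv (gfpOf (FreeGroup.of 1)) = (gfpOf (FreeGroup.of 1))⁻¹ := by
  refine Subtype.ext ?_
  rw [coe_gfpInv, Subgroup.coe_inv]
  change (sigmaHat (eta (FreeGroup.of 1)), (expA (FreeGroup.of 1))⁻¹) =
    ((eta (FreeGroup.of (1 : Fin 2)), expA (FreeGroup.of 1)) : F₂hatT × Multiplicative ℤ)⁻¹
  rw [Prod.inv_mk, sigmaHat_eta, ← map_inv]
  rfl

/-- `Γ (ε_μ) = ε_μ⁻¹` (`ε_μ = inclX b`, `ι(b) = b⁻¹`). [cite: MochizukiEtTh2009, Prop 1.8 p.28] -/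
theorem conjEpsPMχq_epsMu : conjEpsPMχq p (MuTwoSetting.modelχq p 1 2 even_two).epsMu = (MuTwoSetting.modelχq p 1 2 even_two).epsMu⁻¹ := by
  change conjEpsPMχq p (SemidirectProduct.inl (SemidirectProduct.inl (gfpOf (FreeGroup.of 1)))) =
    (SemidirectProduct.inl (SemidirectProduct.inl (gfpOf (FreeGroup.of 1))))⁻¹
  rw [conjEpsPMχq_inl, inversionχq_inl, gfpInv_gfpOf_one, map_inv, map_inv]

/-- The image of a subgroup of `Π^tp_X` under `inclX`, mapped by `Γ`, is the image of its `ι`-translate.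
[cite: MochizukiEtTh2009, Prop 1.8 p.28] -/
theorem map_conjEpsPMχq_map_inl (H : Subgroup (PiTpχq p 1 2)) :
    (H.map (SemidirectProduct.inl : PiTpχq p 1 2 →* PiTpCq p 1 2)).map (conjEpsPMχq p).toMulEquiv.toMonoidHom =
      (H.map (inversionχq p 1 2).toMulEquiv.toMonoidHom).map (SemidirectProduct.inl : PiTpχq p 1 2 →* PiTpCq p 1 2) := by
  rw [Subgroup.map_map, Subgroup.map_map]
  congr 1
  exact MonoidHom.ext fun x => conjEpsPMχq_inl p x

/-- `ι(Π^tp_Ẍ) ≤ Π^tp_Ẍ` at stage 2 (abc-iut-w5-d249's `invActionχq_mem_Xddχq` at `z = 1̄`). [cite: MochizukiEtTh2009, Def 1.7 p.27] -/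
theorem map_Xddχq_inversionχq_le :
    (Xddχq p 1 2 even_two).map (inversionχq p 1 2).toMulEquiv.toMonoidHom ≤ Xddχq p 1 2 even_two := by
  rintro _ ⟨x, hx, rfl⟩
  have h := invActionχq_mem_Xddχq p 1 2 even_two (Multiplicative.ofAdd 1) hx
  rw [invActionχq_ofAdd_one] at h
  exact h

/-- `Γ(Π^tp_Ẋ) ≤ Π^tp_Ẋ` (then `=` by involutivity). [cite: MochizukiEtTh2009, Prop 1.8 p.28] -/
theorem map_conjEpsPMχq_dotX_le :
    ((MuTwoSetting.modelχq p 1 2 even_two).dotX (epsZχq p)).map (conjEpsPMχq p).toMulEquiv.toMonoidHom ≤ (MuTwoSetting.modelχq p 1 2 even_two).dotX (epsZχq p) := by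
  change ((Xddχq p 1 2 even_two).map (SemidirectProduct.inl : PiTpχq p 1 2 →* PiTpCq p 1 2) ⊔
      Subgroup.zpowers (epsZχq p)).map _ ≤
    (Xddχq p 1 2 even_two).map (SemidirectProduct.inl : PiTpχq p 1 2 →* PiTpCq p 1 2) ⊔ Subgroup.zpowers (epsZχq p)
  rw [Subgroup.map_sup]
  refine sup_le_sup ?_ ?_
  · rw [map_conjEpsPMχq_map_inl]
    exact Subgroup.map_mono (map_Xddχq_inversionχq_le p)
  · rw [MonoidHom.map_zpowers]
    change Subgroup.zpowers (conjEpsPMχq p (epsZχq p)) ≤ _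
    rw [conjEpsPMχq_epsZχq, Subgroup.zpowers_inv]

/-- **`Γ` PRESERVES THE COVERINGS** `Π^tp_Ÿ`, `Π^tp_Ẍ`, `Π^tp_Ẋ`, `Π^tp_X`, `Π^tp_Ċ` of `MuTwoSetting.modelχq p 1 2` (with
`ε_Z := a`): the conclusion of Prop. 1.8 for `Γ = conj ε_±` at the stage-2 model. [cite: MochizukiEtTh2009, Prop 1.8 p.28] -/
theorem preservesCoverings_conjEpsPMχq :
    PreservesCoverings (Mα := MuTwoSetting.modelχq p 1 2 even_two) (Mβ := MuTwoSetting.modelχq p 1 2 even_two)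
      (epsZχq p) (epsZχq p) (conjEpsPMχq p) where
  map_Ydd := by
    change ((ThetaSetting.modelχq p 1 2 even_two).GtpYdd.map (SemidirectProduct.inl : PiTpχq p 1 2 →* PiTpCq p 1 2)).map _ =
      (ThetaSetting.modelχq p 1 2 even_two).GtpYdd.map (SemidirectProduct.inl : PiTpχq p 1 2 →* PiTpCq p 1 2)
    rw [map_conjEpsPMχq_map_inl]
    exact congrArg (Subgroup.map (SemidirectProduct.inl : PiTpχq p 1 2 →* PiTpCq p 1 2)) (thm16i_inversionχq p 1 2 even_two)
  map_Xdd := by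
    change ((Xddχq p 1 2 even_two).map (SemidirectProduct.inl : PiTpχq p 1 2 →* PiTpCq p 1 2)).map _ =
      (Xddχq p 1 2 even_two).map (SemidirectProduct.inl : PiTpχq p 1 2 →* PiTpCq p 1 2)
    rw [map_conjEpsPMχq_map_inl]
    congr 1
    exact map_eq_of_le_of_involutive' _ (fun x => inversionχq_inversionχq p 1 2 x) _ (map_Xddχq_inversionχq_le p)
  map_dotX := map_eq_of_le_of_involutive' _ (conjEpsPMχq_conjEpsPMχq p) _ (map_conjEpsPMχq_dotX_le p)
  map_X := by
    refine map_eq_of_le_of_involutive' _ (conjEpsPMχq_conjEpsPMχq p) _ ?_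
    rintro _ ⟨_, ⟨x, rfl⟩, rfl⟩
    exact ⟨inversionχq p 1 2 x, (conjEpsPMχq_inl p x).symm⟩
  map_dotC := by
    refine map_eq_of_le_of_involutive' _ (conjEpsPMχq_conjEpsPMχq p) _ ?_
    change ((MuTwoSetting.modelχq p 1 2 even_two).dotX (epsZχq p) ⊔ Subgroup.zpowers ((MuTwoSetting.modelχq p 1 2 even_two).epsPM * (MuTwoSetting.modelχq p 1 2 even_two).epsMu)).map _ ≤
      (MuTwoSetting.modelχq p 1 2 even_two).dotX (epsZχq p) ⊔ Subgroup.zpowers ((MuTwoSetting.modelχq p 1 2 even_two).epsPM * (MuTwoSetting.modelχq p 1 2 even_two).epsMu)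
    rw [Subgroup.map_sup]
    refine sup_le ((map_conjEpsPMχq_dotX_le p).trans le_sup_left) ?_
    rw [MonoidHom.map_zpowers, Subgroup.zpowers_le]
    -- `Γ(ε_± ε_μ) = ε_± ε_μ⁻¹ = (ε_± ε_μ) · ε_μ⁻²`, and `ε_μ² ∈ inclX(Π^tp_Ẍ) ≤ Π^tp_Ẋ`
    have hΓ : (conjEpsPMχq p).toMulEquiv.toMonoidHom ((MuTwoSetting.modelχq p 1 2 even_two).epsPM * (MuTwoSetting.modelχq p 1 2 even_two).epsMu) =
        (MuTwoSetting.modelχq p 1 2 even_two).epsPM * (MuTwoSetting.modelχq p 1 2 even_two).epsMu * ((MuTwoSetting.modelχq p 1 2 even_two).epsMu * (MuTwoSetting.modelχq p 1 2 even_two).epsMu)⁻¹ := by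
      change conjEpsPMχq p (epsPMχq p * (MuTwoSetting.modelχq p 1 2 even_two).epsMu) = epsPMχq p * _ * _
      rw [map_mul, conjEpsPMχq_epsMu]
      change epsPMχq p * epsPMχq p * (epsPMχq p)⁻¹ * _ = _
      rw [epsPMχq_inv, epsPMχq_mul_self, one_mul, mul_inv_rev, ← mul_assoc, mul_inv_cancel_right]
    rw [hΓ]
    refine Subgroup.mul_mem _ (Subgroup.mem_sup_right (Subgroup.mem_zpowers _)) (Subgroup.inv_mem _ ?_)
    exact Subgroup.mem_sup_left (Subgroup.mem_sup_left (sq_mem_map_inl_Xddχq p 1 2 even_two _))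

/-! ### §3. `γ`: the inner automorphism of `Π^tp_Ċ` by `ε_± · ε_μ` -/

/-- `ε_± · ε_μ ∈ Π^tp_Ċ`. [cite: MochizukiEtTh2009, Def 1.7 p.27] -/
theorem epsPM_mul_epsMu_mem_dotC_tate : (MuTwoSetting.modelχq p 1 2 even_two).epsPM * (MuTwoSetting.modelχq p 1 2 even_two).epsMu ∈ (MuTwoSetting.modelχq p 1 2 even_two).dotC (epsZχq p) :=
  Subgroup.mem_sup_right (Subgroup.mem_zpowers _)

/-- **`γ : Π^tp_Ċ ⥲ Π^tp_Ċ`, the inner automorphism by `ε_± · ε_μ`** (a topological automorphism of the subgroup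
`Π^tp_Ċ ≤ Π^tp_C` of the stage-2 record). DEFINED. [cite: MochizukiEtTh2009, Thm 1.10 p.29] -/
def gammaDotCχq : ↥((MuTwoSetting.modelχq p 1 2 even_two).dotC (epsZχq p)) ≃ₜ* ↥((MuTwoSetting.modelχq p 1 2 even_two).dotC (epsZχq p)) where
  toMulEquiv := MulAut.conj (⟨_, epsPM_mul_epsMu_mem_dotC_tate p⟩ : ↥((MuTwoSetting.modelχq p 1 2 even_two).dotC (epsZχq p)))
  continuous_toFun := by
    change Continuous fun x : ↥((MuTwoSetting.modelχq p 1 2 even_two).dotC (epsZχq p)) =>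
      (⟨_, epsPM_mul_epsMu_mem_dotC_tate p⟩ : ↥((MuTwoSetting.modelχq p 1 2 even_two).dotC (epsZχq p))) * x *
        (⟨_, epsPM_mul_epsMu_mem_dotC_tate p⟩ : ↥((MuTwoSetting.modelχq p 1 2 even_two).dotC (epsZχq p)))⁻¹
    exact (continuous_const.mul continuous_id).mul continuous_const
  continuous_invFun := by
    change Continuous fun x : ↥((MuTwoSetting.modelχq p 1 2 even_two).dotC (epsZχq p)) =>
      (⟨_, epsPM_mul_epsMu_mem_dotC_tate p⟩ : ↥((MuTwoSetting.modelχq p 1 2 even_two).dotC (epsZχq p)))⁻¹ * x *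
        (⟨_, epsPM_mul_epsMu_mem_dotC_tate p⟩ : ↥((MuTwoSetting.modelχq p 1 2 even_two).dotC (epsZχq p)))
    exact (continuous_const.mul continuous_id).mul continuous_const

/-- [cite: MochizukiEtTh2009, Thm 1.10 p.29] -/
theorem gammaDotCχq_apply_coe (x : ↥((MuTwoSetting.modelχq p 1 2 even_two).dotC (epsZχq p))) :
    ((gammaDotCχq p x : ↥((MuTwoSetting.modelχq p 1 2 even_two).dotC (epsZχq p))) : PiTpCq p 1 2) =
      (MuTwoSetting.modelχq p 1 2 even_two).epsPM * (MuTwoSetting.modelχq p 1 2 even_two).epsMu * x * ((MuTwoSetting.modelχq p 1 2 even_two).epsPM * (MuTwoSetting.modelχq p 1 2 even_two).epsMu)⁻¹ := rfl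

/-- **`γ` is NOT the identity** (it moves `ε_Z = a`: `(ε_±ε_μ) a (ε_±ε_μ)⁻¹ = inclX (ι(bab⁻¹))` has degree `−1 ≠ 1`;
the stage-2 inversion reverses degrees, `gfpSnd_left_inversionχq`). [cite: MochizukiEtTh2009, Thm 1.10 p.29] -/
theorem gammaDotCχq_ne_refl : gammaDotCχq p ≠ ContinuousMulEquiv.refl _ := by
  intro h
  have ha' : epsZχq p ∈ (MuTwoSetting.modelχq p 1 2 even_two).dotX (epsZχq p) := Subgroup.mem_sup_right (Subgroup.mem_zpowers _)
  have ha : epsZχq p ∈ (MuTwoSetting.modelχq p 1 2 even_two).dotC (epsZχq p) := Subgroup.mem_sup_left ha'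
  have h1 : ((gammaDotCχq p ⟨epsZχq p, ha⟩ : ↥((MuTwoSetting.modelχq p 1 2 even_two).dotC (epsZχq p))) : PiTpCq p 1 2) = epsZχq p := by
    rw [h]; rfl
  rw [gammaDotCχq_apply_coe] at h1
  -- `(ε_± ε_μ) a (ε_± ε_μ)⁻¹ = Γ (ε_μ a ε_μ⁻¹) = Γ (inclX (b a b⁻¹)) = inclX (ι (b a b⁻¹))`
  have h2 : conjEpsPMχq p (SemidirectProduct.inl
      ((SemidirectProduct.inl (gfpOf (FreeGroup.of 1)) : PiTpχq p 1 2) * SemidirectProduct.inl (gfpOf (FreeGroup.of 0)) *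
        (SemidirectProduct.inl (gfpOf (FreeGroup.of 1)))⁻¹)) = epsZχq p := by
    rw [← h1, conjEpsPMχq_apply, map_mul, map_mul, map_inv]
    change epsPMχq p * (_ * epsZχq p * _) * (epsPMχq p)⁻¹ =
      epsPMχq p * SemidirectProduct.inl (SemidirectProduct.inl (gfpOf (FreeGroup.of 1)) : PiTpχq p 1 2) * epsZχq p *
        (epsPMχq p * SemidirectProduct.inl (SemidirectProduct.inl (gfpOf (FreeGroup.of 1)) : PiTpχq p 1 2))⁻¹
    group
  rw [conjEpsPMχq_inl] at h2
  have h3 := SemidirectProduct.inl_injective h2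
  -- degrees: `toZ (ι x) = (toZ x)⁻¹`, `toZ a = 1 ∈ ℤ`, `toZ b` cancels
  have h4 := congrArg (ThetaSetting.modelχq p 1 2 even_two).toZ h3
  rw [(isInversionAut_inversionχq p 1 2 even_two).toZ_apply, map_mul, map_mul, map_inv, mul_inv_cancel_comm,
    toZ_inl_gfpOf_a p 1 2 even_two] at h4
  exact absurd h4 (by decide)

end Literature.AnabelianGeometry.EtaleTheta.SettingModel

end
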